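import Literature.Analysis.FluidPDE.TaoAveragedSymbolCalculus
import Literature.Analysis.FluidPDE.TaoAveragedComplexAverageLinear
import Literature.Analysis.FluidPDE.TaoAveragedSlotAlgebra
import HarnessLib

/-!
# Tao 2016, §3.2 ¶3: the composite of two complex averages (transitivity of complex averaging)

T. Tao, *Finite time blowup for an averaged three-dimensional Navier–Stokes equation*,
J. Amer. Math. Soc. **29** (2016), 601–674 = arXiv:1402.0290v3 (held as `paper:arxiv-1402.0290`),
§3.2 ¶3, p. 16: "From this [the Leibniz bound], Fubini's theorem, and Hölder's inequality,
together with the observation that rotation and dilation operators normalise `𝓜₀ ⊗ ℂ`, we have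
the following transitivity property: if `C₁` is a complex average of `C₂`, and `C₂` is a complex
average of `C₃`, then `C₁` is a complex average of `C₃`."

This file constructs the **composite complex averaging datum** behind this sentence and proves
its two properties; the discharge `complexAverage_trans_holds` of the named fact
`Literature.Analysis.FluidPDE.Tao2016.complexAverage_trans` (`TaoAveragedCascadeSteps.lean`)
follows in `TaoAveragedCascadeStepsProofs.lean`.

* `ComplexAveragingDatum.compSymbol`, `ComplexAveragingDatum.comp` — for data `𝒟₁` (inner) and
  `𝒟₂` (outer): sample space `Ω₁ × Ω₂` with the product (finite) measure, rotations
  `R_{i,(ω₁,ω₂)} = R_{2,i,ω₂} R_{1,i,ω₁}`, dilation factors `λ₁ λ₂`, and the symbol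
  `m₂(ξ) m₁(λ₂⁻¹ R₂⁻¹ ξ)` of `m₂(D) (Rot_{R₂} Dil_{λ₂} m₁(D) Dil_{λ₂}⁻¹ Rot_{R₂}⁻¹)` ("rotation and
  dilation operators normalise `𝓜₀ ⊗ ℂ`"); the integrability conditions (3.5) of the composite
  follow from the Leibniz bound, the invariance of the seminorms and **Tonelli** on `Ω₁ × Ω₂`
  (`lintegral_prod_compSymbol_lt_top`; this is where the measurability of `ω ↦ ‖m_{i,ω}‖_k`,
  `TaoSymbolSeminormMeasurable.lean`, is needed);
* `ComplexAveragingDatum.comp_slot` — **the slots compose**: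
  `m(D) Rot_{R₂R₁} Dil_{λ₁λ₂} = (m₂(D) Rot_{R₂} Dil_{λ₂}) ∘ (m₁(D) Rot_{R₁} Dil_{λ₁})` (the operator
  identities of `TaoAveragedSlotAlgebra.lean`);
* `ComplexAveragingDatum.comp_average_eulerForm` — **Fubini**: for `u, v` of finite `H¹⁰` norm,
  `∫_{Ω₁×Ω₂} ⟨B(…u, …v), …w⟩ = ∫_{Ω₁} (∫_{Ω₂} ⟨B(A₂A₁u, A₂A₁v), A₂A₁w⟩ dμ₂) dμ₁`, the joint
  integrability being the absolute convergence of (3.4) for the composite datum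
  (`integrable_eulerForm_slot`, Tao p. 7).

## References

* T. Tao, J. Amer. Math. Soc. 29 (2016), 601–674, arXiv:1402.0290v3, §1.1 pp. 6–7, §3.1 Def. 3.4
  (3.4)–(3.5) p. 15, §3.2 ¶3 p. 16. Key `Tao2016AveragedNS`.
-/

noncomputable section

open MeasureTheory Set Filter Topology
open scoped ENNReal NNReal

namespace Literature.Analysis.FluidPDE.Tao2016

namespace ComplexAveragingDatum

variable (𝒟₁ 𝒟₂ : ComplexAveragingDatum)

/-! ### The composite symbol -/

/-- **The symbol of a composite slot**: for `ω = (ω₁, ω₂)`,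
`m_{i,ω}(ξ) = m_{2,i,ω₂}(ξ) · m_{1,i,ω₁}(λ_{2,i,ω₂}⁻¹ R_{2,i,ω₂}⁻¹ ξ)`, the symbol of
`m₂(D) Rot_{R₂} Dil_{λ₂} m₁(D) Dil_{λ₂}⁻¹ Rot_{R₂}⁻¹` ("rotation and dilation operators normalise
`𝓜₀ ⊗ ℂ`", Tao §3.2 ¶3). [cite: Tao2016AveragedNS, §3.2 p. 16] -/
def compSymbol (i : Fin 3) (θ : 𝒟₁.Ω × 𝒟₂.Ω) (ξ : EuclideanSpace ℝ (Fin 3)) : ℂ :=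
  𝒟₂.m i θ.2 ξ * 𝒟₁.m i θ.1 ((𝒟₂.lam i θ.2)⁻¹ • (𝒟₂.R i θ.2).symm ξ)

/-- The composite symbol is a complex Fourier multiplier of order `0` (`𝓜₀ ⊗ ℂ` is closed under
products and normalised by rotations and dilations). [cite: Tao2016AveragedNS, §3.2 p. 16] -/
theorem isComplexSymbol_compSymbol (i : Fin 3) (θ : 𝒟₁.Ω × 𝒟₂.Ω) :
    IsComplexSymbol (compSymbol 𝒟₁ 𝒟₂ i θ) :=
  (𝒟₂.isComplexSymbol i θ.2).mul ((𝒟₁.isComplexSymbol i θ.1).comp_smul_isometry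
    (inv_ne_zero (𝒟₂.lam_pos i θ.2).ne') (𝒟₂.R i θ.2).symm)

/-- The composite symbol is measurable in `ω = (ω₁, ω₂)` off the origin (joint measurability of
`(ω₁, η) ↦ m_{1,i,ω₁}(η)` off the origin, `measurable_symbol_indicator`, composed with the
measurable `ω ↦ λ₂⁻¹ R₂⁻¹ ξ`). [cite: Tao2016AveragedNS, Def. 3.4] -/
theorem measurable_compSymbol (i : Fin 3) {ξ : EuclideanSpace ℝ (Fin 3)} (hξ : ξ ≠ 0) :
    Measurable fun θ : 𝒟₁.Ω × 𝒟₂.Ω => compSymbol 𝒟₁ 𝒟₂ i θ ξ := by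
  have hη : Measurable fun θ : 𝒟₁.Ω × 𝒟₂.Ω => (𝒟₂.lam i θ.2)⁻¹ • (𝒟₂.R i θ.2).symm ξ :=
    (((𝒟₂.measurable_lam i).comp measurable_snd).inv).smul
      ((𝒟₂.measurable_symm_apply i).comp (measurable_snd.prodMk measurable_const))
  have hη0 : ∀ θ : 𝒟₁.Ω × 𝒟₂.Ω, (𝒟₂.lam i θ.2)⁻¹ • (𝒟₂.R i θ.2).symm ξ ∈ ({0}ᶜ : Set _) :=
    fun θ => mapsTo_smul_isometry_compl_zero (inv_ne_zero (𝒟₂.lam_pos i θ.2).ne')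
      (𝒟₂.R i θ.2).symm hξ
  have h1 : Measurable fun θ : 𝒟₁.Ω × 𝒟₂.Ω =>
      𝒟₁.m i θ.1 ((𝒟₂.lam i θ.2)⁻¹ • (𝒟₂.R i θ.2).symm ξ) := by
    have heq : (fun θ : 𝒟₁.Ω × 𝒟₂.Ω => 𝒟₁.m i θ.1 ((𝒟₂.lam i θ.2)⁻¹ • (𝒟₂.R i θ.2).symm ξ)) =
        (fun q : 𝒟₁.Ω × EuclideanSpace ℝ (Fin 3) => Set.indicator {0}ᶜ (𝒟₁.m i q.1) q.2) ∘
          fun θ => (θ.1, (𝒟₂.lam i θ.2)⁻¹ • (𝒟₂.R i θ.2).symm ξ) := by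
      funext θ
      simp only [Function.comp_apply]
      rw [Set.indicator_of_mem (hη0 θ)]
    rw [heq]
    exact (𝒟₁.measurable_symbol_indicator i).comp (measurable_fst.prodMk hη)
  exact ((𝒟₂.measurable_m i ξ hξ).comp measurable_snd).mul h1

/-- The composite rotation `ω ↦ R_{2,i,ω₂} R_{1,i,ω₁} x` is measurable (expand `R₂ y = Σⱼ yⱼ R₂ eⱼ`). [folklore] -/
theorem measurable_trans_apply (i : Fin 3) (x : EuclideanSpace ℝ (Fin 3)) :
    Measurable fun θ : 𝒟₁.Ω × 𝒟₂.Ω => ((𝒟₁.R i θ.1).trans (𝒟₂.R i θ.2)) x := by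
  have key : (fun θ : 𝒟₁.Ω × 𝒟₂.Ω => ((𝒟₁.R i θ.1).trans (𝒟₂.R i θ.2)) x) =
      fun θ => ∑ j, (𝒟₁.R i θ.1 x) j • 𝒟₂.R i θ.2 (EuclideanSpace.single j (1 : ℝ)) := by
    funext θ
    have hy : 𝒟₁.R i θ.1 x = ∑ j, (𝒟₁.R i θ.1 x) j • EuclideanSpace.single j (1 : ℝ) := by
      simpa using ((EuclideanSpace.basisFun (Fin 3) ℝ).sum_repr (𝒟₁.R i θ.1 x)).symm
    rw [LinearIsometryEquiv.trans_apply]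
    conv_lhs => rw [hy]
    simp only [map_sum, LinearIsometryEquiv.map_smul]
  rw [key]
  refine Finset.measurable_fun_sum _ fun j _ => ?_
  exact ((measurable_pi_apply j).comp ((WithLp.measurable_ofLp 2 _).comp
    ((𝒟₁.measurable_R i x).comp measurable_fst))).smul ((𝒟₂.measurable_R i _).comp measurable_snd)

/-- `ω ↦ ∏ᵢ Σ_{j ≤ K} ‖m_{i,ω}‖_j` is measurable. [cite: Tao2016AveragedNS, Def. 3.4 (3.5)] -/
theorem measurable_prod_sum_symbolSeminorm (𝒟 : ComplexAveragingDatum) (K : ℕ) :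
    Measurable fun θ => (∑ j ∈ Finset.range (K + 1), symbolSeminorm j (𝒟.m 0 θ)) *
      (∑ j ∈ Finset.range (K + 1), symbolSeminorm j (𝒟.m 1 θ)) *
        (∑ j ∈ Finset.range (K + 1), symbolSeminorm j (𝒟.m 2 θ)) :=
  ((𝒟.measurable_sum_symbolSeminorm 0 K).mul (𝒟.measurable_sum_symbolSeminorm 1 K)).mul
    (𝒟.measurable_sum_symbolSeminorm 2 K)

/-- **The integrability conditions (3.5) for the composite symbols** (Tao §3.2 ¶3: Leibniz
bound, invariance of the seminorms under rotations and dilations, and Fubini–Tonelli on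
`Ω₁ × Ω₂`): `∫_{Ω₁×Ω₂} ‖m_{1,ω}‖_{k₁} ‖m_{2,ω}‖_{k₂} ‖m_{3,ω}‖_{k₃} d(μ₁ ⊗ μ₂) < ∞`. Each factor is
bounded by `c_k (Σ_{j ≤ K} ‖m_{2,i,ω₂}‖_j)(Σ_{j ≤ K} ‖m_{1,i,ω₁}‖_j)`, `K = k₁ + k₂ + k₃`, and the
product integral splits (Tonelli, measurable factors) into two finite ones. [cite: Tao2016AveragedNS, §3.2 p. 16] -/
theorem lintegral_prod_compSymbol_lt_top (k₁ k₂ k₃ : ℕ) :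
    ∫⁻ θ, symbolSeminorm k₁ (compSymbol 𝒟₁ 𝒟₂ 0 θ) * symbolSeminorm k₂ (compSymbol 𝒟₁ 𝒟₂ 1 θ) *
        symbolSeminorm k₃ (compSymbol 𝒟₁ 𝒟₂ 2 θ) ∂(𝒟₁.μ.prod 𝒟₂.μ) < ∞ := by
  set K : ℕ := k₁ + k₂ + k₃ with hK
  set X : Fin 3 → 𝒟₂.Ω → ℝ≥0∞ := fun i θ₂ =>
    ∑ j ∈ Finset.range (K + 1), symbolSeminorm j (𝒟₂.m i θ₂) with hX
  set Y : Fin 3 → 𝒟₁.Ω → ℝ≥0∞ := fun i θ₁ =>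
    ∑ j ∈ Finset.range (K + 1), symbolSeminorm j (𝒟₁.m i θ₁) with hY
  set c : ℕ → ℝ≥0∞ := fun k => ∑ j ∈ Finset.range (k + 1), (k.choose j : ℝ≥0∞) with hc
  have hb : ∀ (i : Fin 3) {k : ℕ}, k ≤ K → ∀ θ : 𝒟₁.Ω × 𝒟₂.Ω,
      symbolSeminorm k (compSymbol 𝒟₁ 𝒟₂ i θ) ≤ c k * X i θ.2 * Y i θ.1 := fun i k hk θ =>
    symbolSeminorm_mul_comp_le (𝒟₂.isComplexSymbol i θ.2) (𝒟₁.isComplexSymbol i θ.1)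
      (inv_ne_zero (𝒟₂.lam_pos i θ.2).ne') (𝒟₂.R i θ.2).symm hk
  have hXm : Measurable fun θ₂ => X 0 θ₂ * X 1 θ₂ * X 2 θ₂ := 𝒟₂.measurable_prod_sum_symbolSeminorm K
  have hYm : Measurable fun θ₁ => Y 0 θ₁ * Y 1 θ₁ * Y 2 θ₁ := 𝒟₁.measurable_prod_sum_symbolSeminorm K
  have hm : Measurable fun θ : 𝒟₁.Ω × 𝒟₂.Ω =>
      (Y 0 θ.1 * Y 1 θ.1 * Y 2 θ.1) * (X 0 θ.2 * X 1 θ.2 * X 2 θ.2) :=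
    (hYm.comp measurable_fst).mul (hXm.comp measurable_snd)
  have hC : c k₁ * c k₂ * c k₃ < ∞ :=
    ENNReal.mul_lt_top (ENNReal.mul_lt_top (sum_choose_lt_top _) (sum_choose_lt_top _))
      (sum_choose_lt_top _)
  calc ∫⁻ θ, symbolSeminorm k₁ (compSymbol 𝒟₁ 𝒟₂ 0 θ) * symbolSeminorm k₂ (compSymbol 𝒟₁ 𝒟₂ 1 θ) *
        symbolSeminorm k₃ (compSymbol 𝒟₁ 𝒟₂ 2 θ) ∂(𝒟₁.μ.prod 𝒟₂.μ)
      ≤ ∫⁻ θ, (c k₁ * c k₂ * c k₃) *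
          ((Y 0 θ.1 * Y 1 θ.1 * Y 2 θ.1) * (X 0 θ.2 * X 1 θ.2 * X 2 θ.2)) ∂(𝒟₁.μ.prod 𝒟₂.μ) := by
        refine lintegral_mono fun θ => ?_
        calc symbolSeminorm k₁ (compSymbol 𝒟₁ 𝒟₂ 0 θ) * symbolSeminorm k₂ (compSymbol 𝒟₁ 𝒟₂ 1 θ) *
              symbolSeminorm k₃ (compSymbol 𝒟₁ 𝒟₂ 2 θ)
            ≤ (c k₁ * X 0 θ.2 * Y 0 θ.1) * (c k₂ * X 1 θ.2 * Y 1 θ.1) *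
                (c k₃ * X 2 θ.2 * Y 2 θ.1) :=
              mul_le_mul' (mul_le_mul' (hb 0 (by omega) θ) (hb 1 (by omega) θ)) (hb 2 (by omega) θ)
          _ = _ := by ring
    _ = (c k₁ * c k₂ * c k₃) * ((∫⁻ θ₁, Y 0 θ₁ * Y 1 θ₁ * Y 2 θ₁ ∂𝒟₁.μ) *
          (∫⁻ θ₂, X 0 θ₂ * X 1 θ₂ * X 2 θ₂ ∂𝒟₂.μ)) := by
        rw [lintegral_const_mul _ hm, lintegral_prod_mul hYm.aemeasurable hXm.aemeasurable]
    _ < ∞ := ENNReal.mul_lt_top hC (ENNReal.mul_lt_top (𝒟₁.lintegral_sum_symbolSeminorm_lt_top K)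
        (𝒟₂.lintegral_sum_symbolSeminorm_lt_top K))

/-! ### The composite datum -/

/-- **The composite complex averaging datum** (Tao §3.2 ¶3, transitivity): for an inner datum
`𝒟₁` and an outer datum `𝒟₂`, the sample space `Ω₁ × Ω₂` with the finite product measure
`μ₁ ⊗ μ₂`, symbols `m₂(ξ) m₁(λ₂⁻¹ R₂⁻¹ ξ)` (`compSymbol`), rotations `R₂ R₁ ∈ SO(3)`, dilation
factors `λ₁ λ₂ ∈ [(C₁C₂)⁻¹, C₁C₂]`, with the integrability conditions (3.5)
(`lintegral_prod_compSymbol_lt_top`) and the measurability of the data. Its slots are the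
composites `A_{2,i,ω₂} ∘ A_{1,i,ω₁}` (`comp_slot`). [cite: Tao2016AveragedNS, §3.2 p. 16] -/
def comp : ComplexAveragingDatum where
  Ω := 𝒟₁.Ω × 𝒟₂.Ω
  μ := 𝒟₁.μ.prod 𝒟₂.μ
  m := compSymbol 𝒟₁ 𝒟₂
  R i θ := (𝒟₁.R i θ.1).trans (𝒟₂.R i θ.2)
  lam i θ := 𝒟₁.lam i θ.1 * 𝒟₂.lam i θ.2
  isComplexSymbol := isComplexSymbol_compSymbol 𝒟₁ 𝒟₂
  det_R i θ := by
    rw [show (((𝒟₁.R i θ.1).trans (𝒟₂.R i θ.2)).toLinearEquiv :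
          EuclideanSpace ℝ (Fin 3) →ₗ[ℝ] EuclideanSpace ℝ (Fin 3)) =
        ((𝒟₂.R i θ.2).toLinearEquiv : EuclideanSpace ℝ (Fin 3) →ₗ[ℝ] EuclideanSpace ℝ (Fin 3)) ∘ₗ
          ((𝒟₁.R i θ.1).toLinearEquiv : EuclideanSpace ℝ (Fin 3) →ₗ[ℝ] EuclideanSpace ℝ (Fin 3))
        from rfl,
      LinearMap.det_comp, 𝒟₁.det_R, 𝒟₂.det_R, mul_one]
  lam_pos i θ := mul_pos (𝒟₁.lam_pos i θ.1) (𝒟₂.lam_pos i θ.2)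
  lam_bdd := by
    obtain ⟨C₁, hC₁⟩ := 𝒟₁.lam_bdd
    obtain ⟨C₂, hC₂⟩ := 𝒟₂.lam_bdd
    refine ⟨C₁ * C₂, fun i θ => ?_⟩
    have h₁ := hC₁ i θ.1
    have h₂ := hC₂ i θ.2
    have hp₁ : 0 < C₁ := (𝒟₁.lam_pos i θ.1).trans_le h₁.2
    have hp₂ : 0 < C₂ := (𝒟₂.lam_pos i θ.2).trans_le h₂.2
    constructor
    · rw [mul_inv]
      exact mul_le_mul h₁.1 h₂.1 (inv_nonneg.2 hp₂.le) (𝒟₁.lam_pos i θ.1).le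
    · exact mul_le_mul h₁.2 h₂.2 (𝒟₂.lam_pos i θ.2).le hp₁.le
  moment := lintegral_prod_compSymbol_lt_top 𝒟₁ 𝒟₂
  measurable_m i ξ hξ := measurable_compSymbol 𝒟₁ 𝒟₂ i hξ
  measurable_R := measurable_trans_apply 𝒟₁ 𝒟₂
  measurable_lam i := ((𝒟₁.measurable_lam i).comp measurable_fst).mul
    ((𝒟₂.measurable_lam i).comp measurable_snd)

/-- The measure of the composite datum is the product measure. [folklore] -/
theorem comp_μ : (𝒟₁.comp 𝒟₂).μ = 𝒟₁.μ.prod 𝒟₂.μ := rfl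

/-! ### The slots compose -/

/-- **The slots of the composite datum are the composites of the slots**:
`m(D) Rot_{R₂R₁} Dil_{λ₁λ₂} = (m₂(D) Rot_{R₂} Dil_{λ₂}) ∘ (m₁(D) Rot_{R₁} Dil_{λ₁})` with
`m = m₂ · m₁(λ₂⁻¹R₂⁻¹·)` — "rotation and dilation operators normalise `𝓜₀ ⊗ ℂ`":
`Dil_λ m(D) = m(λ⁻¹·)(D) Dil_λ`, `Rot_R m(D) = m(R⁻¹·)(D) Rot_R`, `m₂(D)m₁'(D) = (m₂m₁')(D)`,
`Dil Rot = Rot Dil`, `Rot_{R₂}Rot_{R₁} = Rot_{R₂R₁}`, `Dil_{λ₂}Dil_{λ₁} = Dil_{λ₁λ₂}`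
(`TaoAveragedSlotAlgebra.lean`). [cite: Tao2016AveragedNS, §3.2 p. 16] -/
theorem comp_slot (i : Fin 3) (θ : 𝒟₁.Ω × 𝒟₂.Ω) (u : L2C) :
    (𝒟₁.comp 𝒟₂).slot i θ u = 𝒟₂.slot i θ.2 (𝒟₁.slot i θ.1 u) := by
  have hl₁ := 𝒟₁.lam_pos i θ.1
  have hl₂ := 𝒟₂.lam_pos i θ.2
  have hM₁ : MemLp (𝒟₁.m i θ.1) ∞ (volume : Measure (EuclideanSpace ℝ (Fin 3))) :=
    (𝒟₁.isComplexSymbol i θ.1).memLp_top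
  have hM₂ : MemLp (𝒟₂.m i θ.2) ∞ (volume : Measure (EuclideanSpace ℝ (Fin 3))) :=
    (𝒟₂.isComplexSymbol i θ.2).memLp_top
  have hM₁d : IsComplexSymbol (fun ξ => 𝒟₁.m i θ.1 ((𝒟₂.lam i θ.2)⁻¹ • ξ)) :=
    (𝒟₁.isComplexSymbol i θ.1).comp_smul (inv_ne_zero hl₂.ne')
  have hM₁dr : IsComplexSymbol
      (fun ξ => 𝒟₁.m i θ.1 ((𝒟₂.lam i θ.2)⁻¹ • (𝒟₂.R i θ.2).symm ξ)) :=
    (𝒟₁.isComplexSymbol i θ.1).comp_smul_isometry (inv_ne_zero hl₂.ne') (𝒟₂.R i θ.2).symm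
  have hprod := isComplexSymbol_compSymbol 𝒟₁ 𝒟₂ i θ
  symm
  calc 𝒟₂.slot i θ.2 (𝒟₁.slot i θ.1 u)
      = fourierMultiplier (hM₂.toLp _) (rot (𝒟₂.R i θ.2) (dil (𝒟₂.lam i θ.2)
          (fourierMultiplier (hM₁.toLp _) (rot (𝒟₁.R i θ.1) (dil (𝒟₁.lam i θ.1) u))))) := rfl
    _ = fourierMultiplier (hM₂.toLp _) (rot (𝒟₂.R i θ.2)
          (fourierMultiplier (hM₁d.memLp_top.toLp _)
            (dil (𝒟₂.lam i θ.2) (rot (𝒟₁.R i θ.1) (dil (𝒟₁.lam i θ.1) u))))) := by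
        rw [dil_fourierMultiplier hl₂ hM₁ hM₁d.memLp_top]
    _ = fourierMultiplier (hM₂.toLp _) (fourierMultiplier (hM₁dr.memLp_top.toLp _)
          (rot (𝒟₂.R i θ.2) (dil (𝒟₂.lam i θ.2) (rot (𝒟₁.R i θ.1) (dil (𝒟₁.lam i θ.1) u))))) := by
        rw [rot_fourierMultiplier (𝒟₂.R i θ.2) hM₁d.memLp_top hM₁dr.memLp_top]
    _ = fourierMultiplier (hprod.memLp_top.toLp _)
          (rot (𝒟₂.R i θ.2) (dil (𝒟₂.lam i θ.2) (rot (𝒟₁.R i θ.1) (dil (𝒟₁.lam i θ.1) u)))) :=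
        fourierMultiplier_toLp_comp hM₁dr.memLp_top hM₂ hprod.memLp_top _
    _ = fourierMultiplier (hprod.memLp_top.toLp _)
          (rot ((𝒟₁.R i θ.1).trans (𝒟₂.R i θ.2)) (dil (𝒟₁.lam i θ.1 * 𝒟₂.lam i θ.2) u)) := by
        rw [dil_rot, rot_rot, dil_dil hl₂ hl₁, mul_comm (𝒟₂.lam i θ.2) (𝒟₁.lam i θ.1)]
    _ = (𝒟₁.comp 𝒟₂).slot i θ u := rfl

/-! ### Fubini: the composite average -/

/-- **The composite datum averages `B` to the iterated average** (Fubini; the joint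
integrability on `Ω₁ × Ω₂` is the absolute convergence of (3.4) for the composite datum, Tao
p. 7 and (3.5)): for `u, v` of finite `H¹⁰` norm and `w ∈ L²`,
`∫_{Ω₁×Ω₂} ⟨B(A u, A v), A w⟩ d(μ₁ ⊗ μ₂) = ∫_{Ω₁} (∫_{Ω₂} ⟨B(A₂A₁u, A₂A₁v), A₂A₁w⟩ dμ₂) dμ₁`. [cite: Tao2016AveragedNS, §3.2 p. 16] -/
theorem comp_average_eulerForm {u v : L2C} (hu : FunctionSpaces.eFourierSobolevNorm 10 u < ∞)
    (hv : FunctionSpaces.eFourierSobolevNorm 10 v < ∞) (w : L2C) :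
    (𝒟₁.comp 𝒟₂).average eulerForm u v w =
      ∫ θ₁, 𝒟₂.average eulerForm (𝒟₁.slot 0 θ₁ u) (𝒟₁.slot 1 θ₁ v) (𝒟₁.slot 2 θ₁ w) ∂𝒟₁.μ := by
  have hint := (𝒟₁.comp 𝒟₂).integrable_eulerForm_slot w hu hv
  simp_rw [comp_slot] at hint
  change ∫ θ, eulerForm ((𝒟₁.comp 𝒟₂).slot 0 θ u) ((𝒟₁.comp 𝒟₂).slot 1 θ v)
      ((𝒟₁.comp 𝒟₂).slot 2 θ w) ∂(𝒟₁.μ.prod 𝒟₂.μ) =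
    ∫ θ₁, ∫ θ₂, eulerForm (𝒟₂.slot 0 θ₂ (𝒟₁.slot 0 θ₁ u)) (𝒟₂.slot 1 θ₂ (𝒟₁.slot 1 θ₁ v))
      (𝒟₂.slot 2 θ₂ (𝒟₁.slot 2 θ₁ w)) ∂𝒟₂.μ ∂𝒟₁.μ
  simp_rw [comp_slot]
  exact integral_prod _ hint

end ComplexAveragingDatum

end Literature.Analysis.FluidPDE.Tao2016
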